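import Literature.RingTheory.MvPolynomial.PlueckerStraightening
import Literature.Combinatorics.Enumerative.TwoRowTableaux
import Literature.AlgebraicGeometry.Kloosterman2023.HilbertFunctionFormula
import HarnessLib

/-!
# The postulation of the Grassmannian of lines: `h_{K[p]/P}(d)` for `G(2,n)`, and `(1 + 3s + s²)/(1 − s)^7` for `G(2,5)`

E. Miller, B. Sturmfels, *Combinatorial Commutative Algebra*, GTM 227 (2005), §14.2, Cor. 14.9 [MillerSturmfels2005]:
the semistandard monomials form a `K`-basis of the Plücker algebra `K[p_{ij}]/P` — in the tree as
`PlueckerStraightening.hilbert_plueckerIdeal_eq_card_stdFinset` (`dim_K (K[p]/P)_d = #{semistandard monomials of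
degree d}`, for `2`-subsets: monomials in the `p_{ij}` whose support is a chain in the product order on pairs
`i < j`).  M. Aigner, *A Course in Enumeration*, GTM 238 (2007), Thm. 8.7 / Thm. 8.8 [Aigner2007]: the number of
semistandard tableaux of shape `λ` on `n` letters is `det(h_{λ_i − i + j}(1^n))` — in the tree for `λ = (d, d)` as
`TwoRowTableaux.card_sst2` (`= C(n+d−1,d)² − C(n+d,d+1)·C(n+d−2,d−1)`, Gessel–Viennot).

This file joins the two:
* §1 `colMon` — a two-rowed tableau `(a, b)` (rows weakly increasing, columns `a_t < b_t`) ↦ the exponent vector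
  `Σ_t e_{(a_t, b_t)}` of the monomial `∏_t p_{a_t b_t}`; `colMon_mem_stdFinset` (its support — the set of columns —
  is a chain), **`colMon_injective`** (a tableau is determined by its multiset of columns: peel off the last column,
  which is the maximum of the support) and **`exists_colMon_eq`** (every chain-supported exponent vector of degree
  `d` is the column multiset of a tableau: sort the chain — induction on `d`, removing one copy of the maximum);
  hence **`card_stdFinset_eq_card_sst2`**: `#{semistandard monomials of degree d in the p_{ij}, i<j<n}
  = #SST((d,d); n letters)` [cite: MillerSturmfels2005, §14.2 / Cor. 14.9].
* §2 **`hilbert_plueckerIdeal_succ`** / **`hilbert_plueckerIdeal`**: for `G(2,n)`, `n ≥ 1`, `d ≥ 1`,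
  `dim_K (K[p]/P)_d = C(n+d−1, d)² − C(n+d, d+1)·C(n+d−2, d−1)` (Hodge's postulation formula for lines;
  `hilbert_plueckerIdeal_zero`: `= 1` in degree `0`); and for **`G(2,5) ⊂ ℙ⁹`**: **`hilbert_plueckerIdeal_G25`**
  `dim_K (K[p]/P)_d = C(d+6,6) + 3·C(d+5,6) + C(d+4,6)` — Hilbert series `(1 + 3s + s²)/(1 − s)^7`, a sixfold of
  degree `1 + 3 + 1 = 5` — and `hilbert_plueckerIdeal_G25_chi`, the same in Kloosterman's `χ`-notation
  `χ₇(d) + 3χ₇(d−1) + χ₇(d−2)`: the `(1,3,1)` h-vector that `Kloosterman2025/FlatLimitHilbertFunctions.lean` certifies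
  for the CENTRAL fibre of [Kloosterman2025] Prop. 6.4 (`hilbert_cubicLimitIdeal_eq_grassmannSection`, over
  `(1 − s)^{k+1}`); the printed general fibre is "a linear section of an iterated cone over the Plücker embedding of
  `G(2,5)`", and cones / general linear sections only shift the exponent of `(1 − s)`.

HONEST FRAMING (cell pub-hlocus): certified instances and evidence bearing on the general Hodge conjecture; no
claim. What is NOT formalised: the base change from `K[p_{ij}]/P` to the substituted ideal
`(p₁, p₂, p₃, tp₄, tp₅)` of Prop. 6.4 (transversality of the printed substitution), so "the Hilbert functions of
`I^{(0)}` and `I^{(t)}` coincide" in Prop. 6.4 is certified as: central fibre = `(1,3,1)/(1−s)^{k+1}` (that file) and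
`G(2,5)` itself = `(1,3,1)/(1−s)^7` (this file). No named facts; 0 sorry.
-/

noncomputable section

open MvPolynomial Module Finset
open Literature.Combinatorics.Enumerative.TwoRowTableaux

namespace Literature.RingTheory.MvPolynomial.Pluecker

section Bridge

variable {n : ℕ}

/-- The exponent vector of a two-rowed tableau: the multiset of its columns `(a_t, b_t)`, as a monomial in the
Plücker coordinates `p_{a_t b_t}`. [cite: MillerSturmfels2005, §14.2 (semistandard monomials ↔ tableaux)] -/
def colMon {d : ℕ} (a b : Fin d → Fin n) (h : ∀ t, a t < b t) : Pair n →₀ ℕ :=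
  ∑ t, Finsupp.single ⟨(a t, b t), h t⟩ 1

/-- The degree of `colMon` is the number of columns. [folklore] -/
private theorem degree_colMon {d : ℕ} (a b : Fin d → Fin n) (h : ∀ t, a t < b t) :
    (colMon a b h).degree = d := by
  rw [colMon, map_sum]
  simp [Finsupp.degree_single]

/-- The support of `colMon` consists of columns. [folklore] -/
private theorem exists_of_mem_support_colMon {d : ℕ} {a b : Fin d → Fin n} {h : ∀ t, a t < b t} {s : Pair n}
    (hs : s ∈ (colMon a b h).support) : ∃ t, s = ⟨(a t, b t), h t⟩ := by
  classical
  rw [colMon] at hs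
  obtain ⟨t, -, ht⟩ := Finset.mem_biUnion.mp (Finsupp.support_finsetSum hs)
  exact ⟨t, Finset.mem_singleton.mp (Finsupp.support_single_subset ht)⟩

/-- Every column lies in the support. [folklore] -/
private theorem col_mem_support_colMon {d : ℕ} (a b : Fin d → Fin n) (h : ∀ t, a t < b t) (t : Fin d) :
    (⟨(a t, b t), h t⟩ : Pair n) ∈ (colMon a b h).support := by
  classical
  rw [Finsupp.mem_support_iff, colMon, Finsupp.finsetSum_apply]
  refine Nat.pos_iff_ne_zero.mp (lt_of_lt_of_le zero_lt_one ?_)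
  calc (1 : ℕ) = Finsupp.single (⟨(a t, b t), h t⟩ : Pair n) 1 ⟨(a t, b t), h t⟩ := by simp
    _ ≤ ∑ t', Finsupp.single (⟨(a t', b t'), h t'⟩ : Pair n) 1 ⟨(a t, b t), h t⟩ :=
        Finset.single_le_sum (f := fun t' => Finsupp.single (⟨(a t', b t'), h t'⟩ : Pair n) 1 ⟨(a t, b t), h t⟩)
          (fun _ _ => Nat.zero_le _) (Finset.mem_univ t)

/-- A two-rowed semistandard tableau gives a semistandard monomial of degree `d` (its columns form a chain).
[cite: MillerSturmfels2005, §14.2] -/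
theorem colMon_mem_stdFinset {d : ℕ} {a b : Fin d → Fin n} (ha : Monotone a) (hb : Monotone b)
    (h : ∀ t, a t < b t) : colMon a b h ∈ stdFinset n d := by
  rw [mem_stdFinset]
  refine ⟨fun s hs s' hs' => ?_, degree_colMon a b h⟩
  obtain ⟨t, rfl⟩ := exists_of_mem_support_colMon hs
  obtain ⟨t', rfl⟩ := exists_of_mem_support_colMon hs'
  rcases le_total t t' with htt | htt
  · exact Or.inl ⟨ha htt, hb htt⟩
  · exact Or.inr ⟨ha htt, hb htt⟩

/-- `colMon` only depends on the rows (proof-irrelevant congruence, for dependent rewriting). [folklore] -/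
private theorem colMon_congr {d : ℕ} {a b a' b' : Fin d → Fin n} {h : ∀ t, a t < b t} {h' : ∀ t, a' t < b' t}
    (ha : a = a') (hb : b = b') : colMon a b h = colMon a' b' h' := by
  subst ha hb
  rfl

/-- Peeling off the last column. [folklore] -/
private theorem colMon_succ {d : ℕ} (a b : Fin (d + 1) → Fin n) (h : ∀ t, a t < b t) :
    colMon a b h = colMon (Fin.init a) (Fin.init b) (fun t => h t.castSucc) +
      Finsupp.single ⟨(a (Fin.last d), b (Fin.last d)), h (Fin.last d)⟩ 1 := by
  rw [colMon, Fin.sum_univ_castSucc]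
  rfl

/-- The last column dominates the support (rows are weakly increasing). [folklore] -/
private theorem le_last_of_mem_support {d : ℕ} {a b : Fin (d + 1) → Fin n} (ha : Monotone a) (hb : Monotone b)
    (h : ∀ t, a t < b t) {s : Pair n} (hs : s ∈ (colMon a b h).support) :
    s ≤ ⟨(a (Fin.last d), b (Fin.last d)), h (Fin.last d)⟩ := by
  obtain ⟨t, rfl⟩ := exists_of_mem_support_colMon hs
  exact ⟨ha (Fin.le_last t), hb (Fin.le_last t)⟩

/-- The initial rows of a tableau are weakly increasing. [folklore] -/
private theorem monotone_init {d : ℕ} {α : Type*} [Preorder α] {a : Fin (d + 1) → α} (ha : Monotone a) :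
    Monotone (Fin.init a) :=
  fun _ _ hij => ha (Fin.castSucc_le_castSucc_iff.mpr hij)

/-- Appending a dominating last entry keeps a row weakly increasing. [folklore] -/
private theorem monotone_snoc {d : ℕ} {α : Type*} [Preorder α] {a : Fin d → α} (ha : Monotone a) {x : α}
    (hx : ∀ t, a t ≤ x) : Monotone (Fin.snoc a x : Fin (d + 1) → α) := by
  intro i j hij
  induction j using Fin.lastCases with
  | last =>
    induction i using Fin.lastCases with
    | last => exact le_rfl
    | cast i => rw [Fin.snoc_castSucc, Fin.snoc_last]; exact hx i
  | cast j =>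
    induction i using Fin.lastCases with
    | last => exact absurd (Fin.castSucc_lt_last j) (not_lt.mpr hij)
    | cast i => rw [Fin.snoc_castSucc, Fin.snoc_castSucc]; exact ha (Fin.castSucc_le_castSucc_iff.mp hij)

/-- **A two-rowed tableau is determined by its multiset of columns** (injectivity of tableau ↦ monomial).
[cite: MillerSturmfels2005, §14.2] -/
theorem colMon_injective : ∀ (d : ℕ) (a b a' b' : Fin d → Fin n), Monotone a → Monotone b → Monotone a' →
    Monotone b' → ∀ (h : ∀ t, a t < b t) (h' : ∀ t, a' t < b' t), colMon a b h = colMon a' b' h' → a = a' ∧ b = b'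
  | 0, a, b, a', b', _, _, _, _, _, _, _ => ⟨funext fun t => t.elim0, funext fun t => t.elim0⟩
  | d + 1, a, b, a', b', ha, hb, ha', hb', h, h', heq => by
    have hlast : (⟨(a (Fin.last d), b (Fin.last d)), h (Fin.last d)⟩ : Pair n) =
        ⟨(a' (Fin.last d), b' (Fin.last d)), h' (Fin.last d)⟩ := by
      apply le_antisymm
      · exact le_last_of_mem_support ha' hb' h' (heq ▸ col_mem_support_colMon a b h (Fin.last d))
      · exact le_last_of_mem_support ha hb h (heq.symm ▸ col_mem_support_colMon a' b' h' (Fin.last d))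
    have hinit : colMon (Fin.init a) (Fin.init b) (fun t => h t.castSucc) =
        colMon (Fin.init a') (Fin.init b') (fun t => h' t.castSucc) := by
      have e := heq
      rw [colMon_succ, colMon_succ, hlast] at e
      exact add_right_cancel e
    obtain ⟨h₁, h₂⟩ := colMon_injective d _ _ _ _ (monotone_init ha) (monotone_init hb) (monotone_init ha')
      (monotone_init hb') _ _ hinit
    have hl := Subtype.ext_iff.mp hlast
    simp only [Prod.mk.injEq] at hl
    refine ⟨funext fun i => ?_, funext fun i => ?_⟩
    · induction i using Fin.lastCases with
      | last => exact hl.1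
      | cast j => exact congrFun h₁ j
    · induction i using Fin.lastCases with
      | last => exact hl.2
      | cast j => exact congrFun h₂ j

/-- A chain-supported multiset has a maximum. [folklore] -/
private theorem exists_max_of_isStd {m : Pair n →₀ ℕ} (hm : IsStd m) (hne : m.support.Nonempty) :
    ∃ s₀ ∈ m.support, ∀ s ∈ m.support, s ≤ s₀ := by
  obtain ⟨s₀, hs₀, hmax⟩ := m.support.exists_maximal hne
  refine ⟨s₀, hs₀, fun s hs => ?_⟩
  rcases hm s hs s₀ hs₀ with h | h
  · exact h
  · exact hmax hs h

/-- One peeling step: removing one copy of the maximum `s₀` of a chain-supported `m` of degree `d + 1` leaves a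
semistandard exponent of degree `d`. [folklore] -/
private theorem sub_single_mem_stdFinset {d : ℕ} {m : Pair n →₀ ℕ} (hm : m ∈ stdFinset n (d + 1)) {s₀ : Pair n}
    (hs₀ : s₀ ∈ m.support) :
    m - Finsupp.single s₀ 1 ∈ stdFinset n d ∧ m - Finsupp.single s₀ 1 + Finsupp.single s₀ 1 = m := by
  classical
  obtain ⟨hstd, hdeg⟩ := mem_stdFinset.mp hm
  have hle : Finsupp.single s₀ 1 ≤ m :=
    Finsupp.single_le_iff.mpr (Nat.one_le_iff_ne_zero.mpr (Finsupp.mem_support_iff.mp hs₀))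
  have hm' : m - Finsupp.single s₀ 1 + Finsupp.single s₀ 1 = m := tsub_add_cancel_of_le hle
  have hsub : (m - Finsupp.single s₀ 1).support ⊆ m.support := Finsupp.support_tsub
  refine ⟨mem_stdFinset.mpr ⟨fun s hs t ht => hstd s (hsub hs) t (hsub ht), ?_⟩, hm'⟩
  have e := congrArg Finsupp.degree hm'
  rw [map_add, Finsupp.degree_single, hdeg] at e
  omega

/-- **Every semistandard monomial is the column multiset of a two-rowed tableau** (surjectivity: sort the chain).
[cite: MillerSturmfels2005, §14.2] -/
theorem exists_colMon_eq (d : ℕ) : ∀ m : Pair n →₀ ℕ, m ∈ stdFinset n d →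
    ∃ a b : Fin d → Fin n, ∃ h : ∀ t, a t < b t, Monotone a ∧ Monotone b ∧ colMon a b h = m := by
  classical
  induction d with
  | zero =>
    intro m hm
    obtain ⟨-, hdeg⟩ := mem_stdFinset.mp hm
    refine ⟨Fin.elim0, Fin.elim0, fun t => t.elim0, fun t => t.elim0, fun t => t.elim0, ?_⟩
    rw [(Finsupp.degree_eq_zero_iff m).mp hdeg, colMon]
    exact Finset.sum_of_isEmpty _
  | succ d ih =>
    intro m hm
    obtain ⟨hstd, hdeg⟩ := mem_stdFinset.mp hm
    have hne : m.support.Nonempty := by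
      rw [Finset.nonempty_iff_ne_empty, Ne, Finsupp.support_eq_empty]
      rintro rfl
      rw [map_zero] at hdeg
      exact Nat.succ_ne_zero d hdeg.symm
    obtain ⟨s₀, hs₀, hmax⟩ := exists_max_of_isStd hstd hne
    obtain ⟨hm'std, hm'⟩ := sub_single_mem_stdFinset hm hs₀
    have hsub : (m - Finsupp.single s₀ 1).support ⊆ m.support := Finsupp.support_tsub
    obtain ⟨a', b', h', ha', hb', hcol⟩ := ih _ hm'std
    have hcol_le : ∀ t, (⟨(a' t, b' t), h' t⟩ : Pair n) ≤ s₀ := fun t =>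
      hmax _ (hsub (hcol ▸ col_mem_support_colMon a' b' h' t))
    have hcols : ∀ t, (Fin.snoc a' s₀.1.1 : Fin (d + 1) → Fin n) t < (Fin.snoc b' s₀.1.2 : Fin (d + 1) → Fin n) t := by
      intro t
      induction t using Fin.lastCases with
      | last => rw [Fin.snoc_last, Fin.snoc_last]; exact s₀.2
      | cast j => rw [Fin.snoc_castSucc, Fin.snoc_castSucc]; exact h' j
    refine ⟨Fin.snoc a' s₀.1.1, Fin.snoc b' s₀.1.2, hcols, monotone_snoc ha' fun t => (hcol_le t).1,
      monotone_snoc hb' fun t => (hcol_le t).2, ?_⟩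
    have e₁ : Fin.init (Fin.snoc a' s₀.1.1 : Fin (d + 1) → Fin n) = a' := Fin.init_snoc _ _
    have e₂ : Fin.init (Fin.snoc b' s₀.1.2 : Fin (d + 1) → Fin n) = b' := Fin.init_snoc _ _
    have e₃ : (⟨((Fin.snoc a' s₀.1.1 : Fin (d + 1) → Fin n) (Fin.last d),
        (Fin.snoc b' s₀.1.2 : Fin (d + 1) → Fin n) (Fin.last d)), hcols (Fin.last d)⟩ : Pair n) = s₀ :=
      Subtype.ext (by dsimp only; rw [Fin.snoc_last, Fin.snoc_last])
    rw [colMon_succ, colMon_congr e₁ e₂ (h' := h'), hcol, e₃, hm']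

/-- **Semistandard monomials of degree `d` in the Plücker coordinates of `G(2,n)` ↔ semistandard tableaux of
shape `(d, d)` over `{0, …, n−1}`** (columns ↔ variables `p_{ij}`). [cite: MillerSturmfels2005, §14.2 / Cor. 14.9] -/
theorem card_stdFinset_eq_card_sst2 (n d : ℕ) : (stdFinset n d).card = (sst2 (Fin n) d).card := by
  symm
  refine Finset.card_bij (fun p hp => colMon p.1 p.2 (mem_sst2.mp hp).2.2) (fun p hp => ?_)
    (fun p hp q hq hpq => ?_) (fun m hm => ?_)
  · obtain ⟨ha, hb, h⟩ := mem_sst2.mp hp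
    exact colMon_mem_stdFinset ha hb h
  · obtain ⟨ha, hb, h⟩ := mem_sst2.mp hp
    obtain ⟨ha', hb', h'⟩ := mem_sst2.mp hq
    obtain ⟨h₁, h₂⟩ := colMon_injective d _ _ _ _ ha hb ha' hb' _ _ hpq
    exact Prod.ext h₁ h₂
  · obtain ⟨a, b, h, ha, hb, hcol⟩ := exists_colMon_eq d m hm
    exact ⟨(a, b), mem_sst2.mpr ⟨ha, hb, h⟩, hcol⟩

end Bridge


section Postulation

universe v

variable (K : Type v) [Field K]

/-- **The Hilbert function of the Plücker algebra of `G(2, n+1)`** (Hodge's postulation formula for lines):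
`dim_K (K[p_{ij}]/P)_{k+1} = C(n+k+1, k+1)² − C(n+k+2, k+2)·C(n+k, k)` — the number of semistandard
tableaux of shape `(k+1, k+1)` on `n + 1` letters.
[cite: MillerSturmfels2005, Cor. 14.9] [cite: Aigner2007, Thm. 8.7 and Thm. 8.8, λ = (d,d)] -/
theorem hilbert_plueckerIdeal_succ (n k : ℕ) :
    finrank K (homogeneousSubmodule (Pair (n + 1)) K (k + 1)) -
        finrank K (idealDegree (plueckerIdeal K (n + 1)) (k + 1)) =
      ((n + k + 1).choose (k + 1)) ^ 2 - (n + k + 2).choose (k + 2) * (n + k).choose k := by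
  rw [hilbert_plueckerIdeal_eq_card_stdFinset, card_stdFinset_eq_card_sst2, card_sst2]

/-- Degree `0`: `dim_K (K[p]/P)_0 = 1`. [cite: MillerSturmfels2005, Cor. 14.9] -/
theorem hilbert_plueckerIdeal_zero (n : ℕ) :
    finrank K (homogeneousSubmodule (Pair n) K 0) - finrank K (idealDegree (plueckerIdeal K n) 0) = 1 := by
  rw [hilbert_plueckerIdeal_eq_card_stdFinset, card_stdFinset_eq_card_sst2, card_sst2_zero]

/-- The same in the classical indexing: for `G(2,n)` (`n ≥ 1`) and degree `d ≥ 1`,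
`h_{K[p]/P}(d) = C(n+d−1, d)² − C(n+d, d+1)·C(n+d−2, d−1)`.
[cite: MillerSturmfels2005, Cor. 14.9] [cite: Aigner2007, Thm. 8.7 and Thm. 8.8] -/
theorem hilbert_plueckerIdeal {n d : ℕ} (hn : 1 ≤ n) (hd : 1 ≤ d) :
    finrank K (homogeneousSubmodule (Pair n) K d) - finrank K (idealDegree (plueckerIdeal K n) d) =
      ((n + d - 1).choose d) ^ 2 - (n + d).choose (d + 1) * (n + d - 2).choose (d - 1) := by
  obtain ⟨n, rfl⟩ := Nat.exists_eq_add_of_le' hn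
  obtain ⟨k, rfl⟩ := Nat.exists_eq_add_of_le' hd
  rw [hilbert_plueckerIdeal_succ, show n + 1 + (k + 1) - 1 = n + k + 1 by omega,
    show n + 1 + (k + 1) - 2 = n + k by omega, show n + 1 + (k + 1) = n + k + 2 by omega,
    show k + 1 + 1 = k + 2 by omega, Nat.add_sub_cancel]

/-- `24·C(m+4, 4) = (m+1)(m+2)(m+3)(m+4)`. [folklore] -/
private theorem choose_four_mul (m : ℕ) : 24 * (m + 4).choose 4 = (m + 1) * (m + 2) * (m + 3) * (m + 4) := by
  induction m with
  | zero => decide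
  | succ m ih =>
    have h := Nat.choose_mul_succ_eq (m + 4) 4
    rw [show m + 4 + 1 - 4 = m + 1 by omega, show m + 4 + 1 = m + 1 + 4 by omega] at h
    apply Nat.eq_of_mul_eq_mul_right (Nat.succ_pos m)
    calc 24 * (m + 1 + 4).choose 4 * (m + 1) = 24 * ((m + 4).choose 4 * (m + 1 + 4)) := by rw [h]; ring
      _ = (m + 1) * (m + 2) * (m + 3) * (m + 4) * (m + 1 + 4) := by rw [← mul_assoc, ih]
      _ = (m + 1 + 1) * (m + 1 + 2) * (m + 1 + 3) * (m + 1 + 4) * (m + 1) := by ring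

/-- `720·C(m+6, 6) = (m+1)⋯(m+6)`. [folklore] -/
private theorem choose_six_mul (m : ℕ) :
    720 * (m + 6).choose 6 = (m + 1) * (m + 2) * (m + 3) * (m + 4) * (m + 5) * (m + 6) := by
  induction m with
  | zero => decide
  | succ m ih =>
    have h := Nat.choose_mul_succ_eq (m + 6) 6
    rw [show m + 6 + 1 - 6 = m + 1 by omega, show m + 6 + 1 = m + 1 + 6 by omega] at h
    apply Nat.eq_of_mul_eq_mul_right (Nat.succ_pos m)
    calc 720 * (m + 1 + 6).choose 6 * (m + 1) = 720 * ((m + 6).choose 6 * (m + 1 + 6)) := by rw [h]; ring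
      _ = (m + 1) * (m + 2) * (m + 3) * (m + 4) * (m + 5) * (m + 6) * (m + 1 + 6) := by rw [← mul_assoc, ih]
      _ = (m + 1 + 1) * (m + 1 + 2) * (m + 1 + 3) * (m + 1 + 4) * (m + 1 + 5) * (m + 1 + 6) * (m + 1) := by
          ring

/-- `720·C(m+5, 6) = m(m+1)⋯(m+5)` (zero for `m = 0`). [folklore] -/
private theorem choose_six_mul' (m : ℕ) :
    720 * (m + 5).choose 6 = m * (m + 1) * (m + 2) * (m + 3) * (m + 4) * (m + 5) := by
  cases m with
  | zero => decide
  | succ m => rw [show m + 1 + 5 = m + 6 by omega, choose_six_mul]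

/-- The binomial identity behind the `(1, 3, 1)` h-vector of `G(2,5)`:
`C(k+5,4)² = C(k+6,4)·C(k+4,4) + C(k+7,6) + 3·C(k+6,6) + C(k+5,6)`. [folklore] -/
private theorem choose_identity_G25 (k : ℕ) :
    ((k + 5).choose 4) ^ 2 =
      (k + 6).choose 4 * (k + 4).choose 4 + ((k + 7).choose 6 + 3 * (k + 6).choose 6 + (k + 5).choose 6) := by
  have h₁ := choose_four_mul (k + 1)
  have h₂ := choose_four_mul (k + 2)
  have h₃ := choose_four_mul k
  have h₄ := choose_six_mul (k + 1)
  have h₅ := choose_six_mul k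
  have h₆ := choose_six_mul' k
  rw [show k + 1 + 4 = k + 5 by omega] at h₁
  rw [show k + 2 + 4 = k + 6 by omega] at h₂
  rw [show k + 1 + 6 = k + 7 by omega] at h₄
  have e₁ : ((k + 5).choose 4 : ℚ) = (k + 1 + 1) * (k + 1 + 2) * (k + 1 + 3) * (k + 1 + 4) / 24 := by
    have := congrArg (Nat.cast : ℕ → ℚ) h₁; push_cast at this; linarith
  have e₂ : ((k + 6).choose 4 : ℚ) = (k + 2 + 1) * (k + 2 + 2) * (k + 2 + 3) * (k + 2 + 4) / 24 := by
    have := congrArg (Nat.cast : ℕ → ℚ) h₂; push_cast at this; linarith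
  have e₃ : ((k + 4).choose 4 : ℚ) = (k + 1) * (k + 2) * (k + 3) * (k + 4) / 24 := by
    have := congrArg (Nat.cast : ℕ → ℚ) h₃; push_cast at this; linarith
  have e₄ : ((k + 7).choose 6 : ℚ) =
      (k + 1 + 1) * (k + 1 + 2) * (k + 1 + 3) * (k + 1 + 4) * (k + 1 + 5) * (k + 1 + 6) / 720 := by
    have := congrArg (Nat.cast : ℕ → ℚ) h₄; push_cast at this; linarith
  have e₅ : ((k + 6).choose 6 : ℚ) = (k + 1) * (k + 2) * (k + 3) * (k + 4) * (k + 5) * (k + 6) / 720 := by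
    have := congrArg (Nat.cast : ℕ → ℚ) h₅; push_cast at this; linarith
  have e₆ : ((k + 5).choose 6 : ℚ) = k * (k + 1) * (k + 2) * (k + 3) * (k + 4) * (k + 5) / 720 := by
    have := congrArg (Nat.cast : ℕ → ℚ) h₆; push_cast at this; linarith
  have goal : (((k + 5).choose 4 : ℕ) : ℚ) ^ 2 = ((k + 6).choose 4 : ℕ) * ((k + 4).choose 4 : ℕ) +
      ((((k + 7).choose 6 : ℕ) : ℚ) + 3 * ((k + 6).choose 6 : ℕ) + ((k + 5).choose 6 : ℕ)) := by
    rw [e₁, e₂, e₃, e₄, e₅, e₆]; ring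
  exact_mod_cast goal

/-- **The Grassmannian `G(2,5) ⊂ ℙ⁹`: `h_{K[p]/P}(d) = C(d+6,6) + 3·C(d+5,6) + C(d+4,6)`**, i.e. Hilbert series
`(1 + 3s + s²)/(1 − s)^7` (a sixfold of degree `5`) — the value quoted for the general fibre in Kloosterman's
Prop. 6.4 ("a linear section of an iterated cone over the Plücker embedding of `G(2,5)`"; cones and general linear
sections only change the exponent of `(1 − s)`). [cite: MillerSturmfels2005, Cor. 14.9] [cite: Aigner2007, Thm. 8.8] -/
theorem hilbert_plueckerIdeal_G25 (d : ℕ) :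
    finrank K (homogeneousSubmodule (Pair 5) K d) - finrank K (idealDegree (plueckerIdeal K 5) d) =
      (d + 6).choose 6 + 3 * (d + 5).choose 6 + (d + 4).choose 6 := by
  cases d with
  | zero => rw [hilbert_plueckerIdeal_zero]; decide
  | succ k =>
    refine (hilbert_plueckerIdeal_succ K 4 k).trans ?_
    rw [show 4 + k + 1 = (k + 1) + 4 by ring, Nat.choose_symm_add, show 4 + k + 2 = (k + 2) + 4 by ring,
      Nat.choose_symm_add, show 4 + k = k + 4 by ring, Nat.choose_symm_add, show k + 1 + 4 = k + 5 by ring,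
      show k + 2 + 4 = k + 6 by ring, show k + 1 + 6 = k + 7 by ring, show k + 1 + 5 = k + 6 by ring]
    have := choose_identity_G25 k
    omega

open Literature.AlgebraicGeometry.Kloosterman2023 in
/-- The same Hilbert function in Kloosterman's `χ`-notation (`χ_v(m) = C(m+v−1, v−1)`, `= 0` for `m < 0`):
`h(d) = χ₇(d) + 3χ₇(d−1) + χ₇(d−2)` — the `(1, 3, 1)` h-vector over `(1 − s)^7`, matching the central fibre
`hilbert_cubicLimitIdeal_eq_grassmannSection` of Prop. 6.4 up to the number of cone variables.
[cite: MillerSturmfels2005, Cor. 14.9] [cite: Kloosterman2025, Prop. 6.4 (proof)] -/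
theorem hilbert_plueckerIdeal_G25_chi (d : ℕ) :
    ((finrank K (homogeneousSubmodule (Pair 5) K d) - finrank K (idealDegree (plueckerIdeal K 5) d) : ℕ) : ℤ) =
      chi 7 d + 3 * chi 7 ((d : ℤ) - 1) + chi 7 ((d : ℤ) - 2) := by
  rw [hilbert_plueckerIdeal_G25, chi_natCast 6 d]
  rcases d with _ | _ | k
  · rw [chi_of_neg 7 (by norm_num), chi_of_neg 7 (by norm_num)]
    decide
  · rw [show (((0 + 1 : ℕ) : ℤ)) - 1 = ((0 : ℕ) : ℤ) by norm_num, chi_natCast 6 0, chi_of_neg 7 (by norm_num)]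
    decide
  · rw [show (((k + 1 + 1 : ℕ) : ℤ)) - 1 = ((k + 1 : ℕ) : ℤ) by push_cast; ring,
      show (((k + 1 + 1 : ℕ) : ℤ)) - 2 = ((k : ℕ) : ℤ) by push_cast; ring, chi_natCast 6 (k + 1), chi_natCast 6 k,
      show k + 1 + 1 + 5 = k + 1 + 6 by ring, show k + 1 + 1 + 4 = k + 6 by ring]
    push_cast
    ring

end Postulation

end Literature.RingTheory.MvPolynomial.Pluecker

end
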